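import Literature.Probability.LatticeModels.PlanarIsingLegendreSpinor
import Literature.Probability.LatticeModels.LatticeLaplacian
import Mathlib.Analysis.Complex.CauchyIntegral
import Mathlib.Analysis.SpecialFunctions.Pow.Deriv
import Mathlib.Analysis.SpecialFunctions.Integrability.Basic
import Mathlib.MeasureTheory.Integral.IntervalIntegral.Periodic
import Mathlib.MeasureTheory.Integral.IntervalIntegral.IntegrationByParts
import Mathlib.MeasureTheory.Function.SpecialFunctions.Basic
import HarnessLib

/-!
# The harmonic measure of the tip of a diagonal slit in `ℤ²`, in closed form

Topic `Literature/Probability/LatticeModels`; discrete potential theory on `ℤ²` for the analytic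
core (§3.2) of Chelkak–Hongler–Izyurov, *Conformal invariance of spin correlations in the planar
Ising model*, Ann. of Math. 181 (2015) = arXiv:1202.2838 (CHI), behind the named fact
`Literature.Probability.LatticeModels.chi_onePoint_rho` (CHI Thm 1.3). CHI's full-plane spinor
`F_{[ℂ_δ,a]}` (Lemma 2.14) is built in §3.2.1–3.2.2 from the **discrete harmonic measure
`hm^{Ξ_δ}_{a+3δ/2}` of the tip of the slit `L_a = {a + x : x ≤ δ/2}` in the lattice `𝒱¹_{ℂ_δ}`**
("First, we define the (real) values of `F_{[ℂ_δ,a]}` on `𝒱¹_{ℂ_δ}` as a discrete harmonic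
measure of the tip point `a + 3δ/2` in the slit discrete plane `𝒱¹_{ℂ_δ} ∖ {a + x, x ≤ 0}`",
proof of Lemma 2.14), and its analysis (Lemmas 3.3–3.4, the estimate (2.16) `ϑ(δ) ≍ δ^{1/2}`)
rests on Kesten's discrete Beurling estimate with the optimal exponent `1/2` (H. Kesten 1987;
G. Lawler, *Intersections of Random Walks* (1991), §2.4, (2.37)–(2.41): the escape probability from
the end point of a half-line to distance `n` is `≍ n^{-1/2}`).

In the tree's coordinates (sites of `ℤ²` = CHI's faces = the corners `𝒱¹`, nearest neighbours of
`𝒱¹` = diagonal steps `±δ ± iδ` of CHI's picture) the cut `L_a ∩ 𝒱¹` is the **diagonal ray**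
`{(-j, -j) : j ≥ 1}` and the tip `a + 3δ/2` is the origin. This file constructs the tip harmonic
measure **in closed form** and proves its defining local properties and its exact values on the
diagonal; in the coordinates `k = a + b`, `s = a - b` of a site `(a, b)` (so that the four lattice
neighbours are `(k ± 1, s ± 1)` and the diagonal is the row `s = 0`):

  `K(k, s) = (1/π) ∫_{-π/2}^{π/2} Re( e^{-ikt} (1 - e^{2it})^{-1/2} ) · y(t)^{|s|} dt`,

with `y(t) = (1 - |sin t|)/cos t = tan(π/4 - |t|/2)` — the decaying modes of the four-point
("diagonal") Laplacian already used for Chelkak–Hongler–Mahfouf's Legendre kernel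
(`PlanarIsingLegendreSpinor.lean`, `chmY`, CHM 2024 App., Lemma 6.2: `y = ½ cos t (1 + y²)`), and
`ĝ(t) = (1 - e^{2it})^{-1/2}` (principal branch) the Wiener–Hopf factor of the row symbol
`|sin t| = 1 - y cos t`: `|ĝ(t)|² |sin t| = ½`.

## Main statements (everything PROVED; no named fact)

* Part A (complex analysis on the unit circle): the boundary integrals
  `J_a(r, m) = ∫_{-π}^{π} e^{-imθ}(1 - re^{iθ})^a dθ` vanish for `m ≤ -1` and equal `2π` at `m = 0`
  when `|r| < 1` (Cauchy–Goursat / Cauchy's formula, `Mathlib`'s `circleIntegral`); integration by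
  parts and the identity `x^{-1/2} - x^{1/2} = x^{-1/2}(1 - x)` relate `a = ∓1/2`; dominated
  convergence (`|1 - re^{iθ}| ≥ |θ|/π` for `r ∈ [1/2, 1]`) passes to `r = 1`, where the Taylor
  coefficients `c_m` of `(1 - w)^{-1/2}` satisfy the Wallis recurrence `c_m = c_{m-1}(2m-1)/(2m)`:
  **`tipCoeff_natCast : c_m = binom(2m, m)/4^m`**, `tipCoeff_of_neg : c_m = 0 (m < 0)`, and the
  coefficients `d_m` of `(1 - w)^{1/2}`: `d_m = -c_{m-1}/(2m)`, `d_0 = 1`, `d_m = 0 (m < 0)`.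
* Part B (the kernel): integrability (`|ĝ| = (2|sin t|)^{-1/2} ≤ |t|^{-1/2}` on `[-π/2, π/2]`);
  **`slitKernel_harmonic`** — the four-point mean value property for `s ≥ 1`;
  **`slitCFun_re_mul_abs_sin`** — the Wiener–Hopf identity
  `Re(e^{-ikt}ĝ)|sin t| = ½ Re(e^{ikt}(1 - e^{2it})^{1/2})`; whence by the substitution `u = 2t`
  the row values and row defects are the coefficients of Part A:
  **`slitKernel_two_mul_natCast_zero : K(2m, 0) = binom(2m,m)/4^m`** (`m ≥ 0`; `K(0,0) = 1`),
  **`slitKernel_two_mul_zero_of_neg : K(2m, 0) = 0`** for `m ≤ -1` (the slit),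
  **`slitKernel_row_of_pos`** — harmonicity at `(2m, 0)`, `m ≥ 1`, **`slitKernel_row_zero`** — the
  source `K(0,0) - ½[K(-1,1) + K(1,1)] = ½` at the tip, `slitKernel_row_of_neg` — the flux into the
  slit; and **Kesten's exponent with the Wallis constant**,
  `slitKernel_two_mul_natCast_zero_le : K(2m, 0) ≤ 1/√(2m+1)`.
* Part C (`ℤ²`): `slitHM (a, b) = K(a+b, |a-b|)` is `latticeLaplacian`-harmonic at every site off the
  diagonal and at `(j, j)`, `j ≥ 1`; `slitHM 0 = 1`, `Δ slitHM (0) = -2`; `slitHM (j, j) = 0` for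
  `j ≤ -1`; `slitHM (j, j) = binom(2j, j)/4^j ≤ 1/√(2j+1)` for `j ≥ 0`
  (`latticeLaplacian_slitHM_of_ne`, `latticeLaplacian_slitHM_diag_of_pos`, `slitHM_zero`,
  `latticeLaplacian_slitHM_zero`, `slitHM_diag_of_neg`, `slitHM_diag`, `slitHM_diag_le`).

So `slitHM` is a solution of the defining problem of CHI's `F¹_{[ℂ_δ,a]} = hm^{Ξ}_{a+3δ/2}`
(harmonic on `𝒱¹ ∖ (L_a ∪ {tip})`, `0` on `L_a`, `1` at the tip), and CHI's normalising factor
`ϑ(δ) = F(a + 1)` (2.15) evaluated on this solution is the central binomial probability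
`binom(2n,n)/4^n ∈ [1/(2√n), 1/√(2n+1)]`, `n ≍ 1/δ` — the two-sided estimate (2.16) with explicit
constants. NOT in this file (sequels): the decay of `K` at infinity and hence its identification
with the harmonic measure (uniqueness of bounded solutions), positivity off the diagonal, the
asymptotics `K(k,s) ≈ √(2/π) Re (k + ½ + i|s|)^{-1/2}` (CHI Lemma 3.4 (iii) / Lemma 2.14
convergence), the harmonic conjugate on the odd sublattice (CHI's `F^i`, s-holomorphicity) and the
primitive `G_{[ℂ_δ,a]}` (Lemma 2.16). The closed form itself is elementary and is verified here
from scratch; we cite CHI for the object and its role, Kesten/Lawler for the exponent, CHM for the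
mode function `y`.

## References

* D. Chelkak, C. Hongler, K. Izyurov, Ann. of Math. 181 (2015) 1087–1138 = arXiv:1202.2838, §2.6
  (Lemma 2.14, (2.15)–(2.16)), §3.2.1–3.2.2 (Lemma 3.3, Lemma 3.4, proof of Lemma 2.14)
  [ChelkakHonglerIzyurovAnnals2015].
* H. Kesten, *Hitting probabilities of random walks on `ℤ^d`*, Stoch. Proc. Appl. 25 (1987) 165–184
  [Kesten1987].
* G. F. Lawler, *Intersections of Random Walks*, Birkhäuser 1991, §2.4, (2.37)–(2.41) [Lawler1991].
* D. Chelkak, C. Hongler, R. Mahfouf, Ann. Inst. Fourier 74 (2024) = arXiv:1904.09168, App. §6,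
  Lemma 6.2 (the modes `y(t)`) [ChelkakHonglerMahfouf2024].
-/

noncomputable section

open Complex MeasureTheory intervalIntegral Set Filter Topology Metric
open scoped Real ComplexConjugate Interval

namespace Literature.Probability.LatticeModels

/-! ### Part A. The boundary integrals `∫_{-π}^{π} e^{-imθ} (1 - r e^{iθ})^a dθ` -/

/-- `b_r(θ) = 1 - r e^{iθ}`. [folklore] -/
def circBase (r θ : ℝ) : ℂ := 1 - r * cexp (θ * I)

/-- Real part of `b_r(θ)`. [folklore] -/
theorem circBase_re (r θ : ℝ) : (circBase r θ).re = 1 - r * Real.cos θ := by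
  simp [circBase, Complex.exp_ofReal_mul_I_re]

/-- `b_r(θ)` lies in the slit plane as soon as `r cos θ < 1`. [folklore] -/
theorem circBase_mem_slitPlane {r θ : ℝ} (h : r * Real.cos θ < 1) : circBase r θ ∈ slitPlane := by
  rw [mem_slitPlane_iff, circBase_re]
  left; linarith

/-- For `|r| < 1`, `b_r(θ)` lies in the slit plane. [folklore] -/
theorem circBase_mem_slitPlane_of_abs_lt {r : ℝ} (hr : |r| < 1) (θ : ℝ) : circBase r θ ∈ slitPlane := by
  apply circBase_mem_slitPlane
  have h1 : r * Real.cos θ ≤ |r| := by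
    calc r * Real.cos θ ≤ |r * Real.cos θ| := le_abs_self _
      _ = |r| * |Real.cos θ| := abs_mul _ _
      _ ≤ |r| * 1 := by gcongr; exact Real.abs_cos_le_one θ
      _ = |r| := mul_one _
  linarith

/-- For `θ ∈ (-π, π]`, `θ ≠ 0`, `b_1(θ) = 1 - e^{iθ}` lies in the slit plane. [folklore] -/
theorem circBase_one_mem_slitPlane {θ : ℝ} (hθ : θ ∈ Ioc (-π) π) (h0 : θ ≠ 0) :
    circBase 1 θ ∈ slitPlane := by
  apply circBase_mem_slitPlane
  rw [one_mul]
  have hc : Real.cos θ ≠ 1 := by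
    intro h
    have := (Real.cos_eq_one_iff_of_lt_of_lt (by linarith [hθ.1, Real.pi_pos])
      (by linarith [hθ.2, Real.pi_pos])).1 h
    exact h0 this
  exact lt_of_le_of_ne (Real.cos_le_one θ) hc

/-- The derivative of `θ ↦ e^{iθ}`. [folklore] -/
theorem hasDerivAt_cexp_mul_I (θ : ℝ) :
    HasDerivAt (fun x : ℝ => cexp (x * I)) (cexp (θ * I) * I) θ := by
  have h1 : HasDerivAt (fun x : ℝ => (x : ℂ) * I) (1 * I) θ := (hasDerivAt_id θ).ofReal_comp.mul_const I
  have h2 := h1.cexp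
  simpa using h2

/-- The derivative of `b_r`. [folklore] -/
theorem hasDerivAt_circBase (r θ : ℝ) :
    HasDerivAt (circBase r) (-(r * (cexp (θ * I) * I))) θ := by
  unfold circBase
  exact ((hasDerivAt_cexp_mul_I θ).const_mul (r : ℂ)).const_sub 1

/-- `b_r` is continuous in `θ`. [folklore] -/
theorem continuous_circBase (r : ℝ) : Continuous (circBase r) := by
  unfold circBase; fun_prop

/-- `b_r(θ)` is continuous in `r`. [folklore] -/
theorem continuous_circBase_left (θ : ℝ) : Continuous fun r : ℝ => circBase r θ := by
  unfold circBase; fun_prop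

/-- `b_r` is `2π`-periodic. [folklore] -/
theorem circBase_add_two_pi (r θ : ℝ) : circBase r (θ + 2 * π) = circBase r θ := by
  unfold circBase
  rw [show ((θ + 2 * π : ℝ) : ℂ) * I = θ * I + 2 * π * I by push_cast; ring, Complex.exp_add,
    Complex.exp_two_pi_mul_I, mul_one]

/-- `e^{-im(θ + 2π)} = e^{-imθ}` for an integer `m`. [folklore] -/
theorem cexp_neg_int_mul_add_two_pi (m : ℤ) (θ : ℝ) :
    cexp (-((m : ℂ) * ((θ + 2 * π : ℝ) : ℂ) * I)) = cexp (-((m : ℂ) * (θ : ℂ) * I)) := by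
  rw [show -((m : ℂ) * ((θ + 2 * π : ℝ) : ℂ) * I) = -((m : ℂ) * (θ : ℂ) * I) + (-m : ℤ) * (2 * π * I) by
    push_cast; ring, Complex.exp_add, Complex.exp_int_mul_two_pi_mul_I, mul_one]

/-- The boundary integral `J_a(r, m) = ∫_{-π}^{π} e^{-imθ} (1 - r e^{iθ})^a dθ`. [folklore] -/
def coefInt (a : ℂ) (r : ℝ) (m : ℤ) : ℂ :=
  ∫ θ in (-π)..π, cexp (-((m : ℂ) * (θ : ℂ) * I)) * circBase r θ ^ a

/-- The integrand of `J_a(r, m)` is `2π`-periodic. [folklore] -/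
theorem periodic_coefIntegrand (a : ℂ) (r : ℝ) (m : ℤ) :
    Function.Periodic (fun θ : ℝ => cexp (-((m : ℂ) * (θ : ℂ) * I)) * circBase r θ ^ a) (2 * π) := by
  intro θ
  simp only
  rw [cexp_neg_int_mul_add_two_pi, circBase_add_two_pi]

/-- `J_a(r, m)` as an integral over `[0, 2π]`. [folklore] -/
theorem coefInt_eq_integral_zero (a : ℂ) (r : ℝ) (m : ℤ) :
    coefInt a r m = ∫ θ in (0 : ℝ)..2 * π, cexp (-((m : ℂ) * (θ : ℂ) * I)) * circBase r θ ^ a := by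
  have h := (periodic_coefIntegrand a r m).intervalIntegral_add_eq (-π) 0
  rw [show -π + 2 * π = π by ring, zero_add] at h
  exact h

/-- For `|r| < 1` the function `w ↦ (1 - r w)^a` is complex differentiable on the closed unit disc.
[folklore] -/
theorem differentiableAt_one_sub_mul_cpow {r : ℝ} (hr : |r| < 1) (a : ℂ) {w : ℂ} (hw : ‖w‖ ≤ 1) :
    DifferentiableAt ℂ (fun w : ℂ => (1 - r * w) ^ a) w := by
  have h0 : (1 - (r : ℂ) * w) ∈ slitPlane := by
    rw [mem_slitPlane_iff]; left
    simp only [sub_re, one_re, mul_re, ofReal_re, ofReal_im, zero_mul, sub_zero]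
    have h1 : r * w.re ≤ |r| * ‖w‖ := by
      calc r * w.re ≤ |r * w.re| := le_abs_self _
        _ = |r| * |w.re| := abs_mul _ _
        _ ≤ |r| * ‖w‖ := by gcongr; exact abs_re_le_norm w
    have h2 : |r| * ‖w‖ ≤ |r| * 1 := by gcongr
    linarith
  exact (((hasDerivAt_id w).const_mul (r : ℂ)).const_sub 1).cpow_const h0 |>.differentiableAt

/-- **Cauchy–Goursat on the unit circle**: for `|r| < 1` and `n ∈ ℕ`,
`∫_0^{2π} e^{i(n+1)θ} (1 - r e^{iθ})^a dθ = 0`. [folklore] -/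
theorem integral_cexp_nat_succ_mul_circBase_cpow {r : ℝ} (hr : |r| < 1) (a : ℂ) (n : ℕ) :
    ∫ θ in (0 : ℝ)..2 * π, cexp (((n : ℂ) + 1) * (θ : ℂ) * I) * circBase r θ ^ a = 0 := by
  set F : ℂ → ℂ := fun w => w ^ n * (1 - r * w) ^ a with hF
  have hd : ∀ w : ℂ, ‖w‖ ≤ 1 → DifferentiableAt ℂ F w := fun w hw =>
    (differentiableAt_id.pow n).mul (differentiableAt_one_sub_mul_cpow hr a hw)
  have hc : ContinuousOn F (closedBall 0 1) := fun w hw =>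
    (hd w (by simpa using hw)).continuousAt.continuousWithinAt
  have h := circleIntegral_eq_zero_of_differentiable_on_off_countable zero_le_one countable_empty hc
    (fun w hw => hd w (by have := hw.1; rw [mem_ball_zero_iff] at this; exact this.le))
  unfold circleIntegral at h
  have key : ∀ θ : ℝ, deriv (circleMap 0 1) θ • F (circleMap 0 1 θ) =
      I * (cexp (((n : ℂ) + 1) * (θ : ℂ) * I) * circBase r θ ^ a) := by
    intro θ
    rw [deriv_circleMap, circleMap_zero, hF]
    simp only [ofReal_one, one_mul, smul_eq_mul, circBase]
    rw [show ((n : ℂ) + 1) * (θ : ℂ) * I = (n : ℕ) * (θ * I) + θ * I by ring, Complex.exp_add,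
      Complex.exp_nat_mul]
    ring
  simp_rw [key] at h
  rw [intervalIntegral.integral_const_mul] at h
  exact (mul_eq_zero.1 h).resolve_left I_ne_zero

/-- **Cauchy's formula at the centre**: for `|r| < 1`, `∫_0^{2π} (1 - r e^{iθ})^a dθ = 2π`. [folklore] -/
theorem integral_circBase_cpow {r : ℝ} (hr : |r| < 1) (a : ℂ) :
    ∫ θ in (0 : ℝ)..2 * π, circBase r θ ^ a = 2 * π := by
  set F : ℂ → ℂ := fun w => (1 - r * w) ^ a with hF
  have hd : ∀ w : ℂ, ‖w‖ ≤ 1 → DifferentiableAt ℂ F w := fun w hw =>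
    differentiableAt_one_sub_mul_cpow hr a hw
  have hc : ContinuousOn F (closedBall 0 1) := fun w hw =>
    (hd w (by simpa using hw)).continuousAt.continuousWithinAt
  have h := circleIntegral_sub_inv_smul_of_differentiable_on_off_countable countable_empty
    (mem_ball_self zero_lt_one) hc
    (fun w hw => hd w (by have := hw.1; rw [mem_ball_zero_iff] at this; exact this.le))
  have hF0 : F 0 = 1 := by simp [hF]
  rw [hF0] at h
  unfold circleIntegral at h
  have key : ∀ θ : ℝ, deriv (circleMap 0 1) θ • ((circleMap 0 1 θ - 0)⁻¹ • F (circleMap 0 1 θ)) =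
      I * circBase r θ ^ a := by
    intro θ
    rw [deriv_circleMap, circleMap_zero, hF]
    simp only [ofReal_one, one_mul, smul_eq_mul, circBase, sub_zero]
    have hne : cexp (θ * I) ≠ 0 := Complex.exp_ne_zero _
    field_simp
  simp_rw [key] at h
  rw [intervalIntegral.integral_const_mul, smul_eq_mul, mul_one] at h
  have h2 : I * (∫ θ in (0 : ℝ)..2 * π, circBase r θ ^ a) = I * (2 * π) := by
    rw [h]; ring
  exact mul_left_cancel₀ I_ne_zero h2

/-- `J_a(r, m) = 0` for `m ≤ -1` and `|r| < 1`. [folklore] -/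
theorem coefInt_eq_zero_of_neg {r : ℝ} (hr : |r| < 1) (a : ℂ) {m : ℤ} (hm : m ≤ -1) :
    coefInt a r m = 0 := by
  rw [coefInt_eq_integral_zero]
  obtain ⟨n, hn⟩ : ∃ n : ℕ, m = -((n : ℤ) + 1) := ⟨(-m - 1).toNat, by omega⟩
  have key : ∀ θ : ℝ, cexp (-((m : ℂ) * (θ : ℂ) * I)) = cexp (((n : ℂ) + 1) * (θ : ℂ) * I) := by
    intro θ; rw [hn]; push_cast; ring_nf
  simp_rw [key]
  exact integral_cexp_nat_succ_mul_circBase_cpow hr a n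

/-- `J_a(r, 0) = 2π` for `|r| < 1`. [folklore] -/
theorem coefInt_zero {r : ℝ} (hr : |r| < 1) (a : ℂ) : coefInt a r 0 = 2 * π := by
  rw [coefInt_eq_integral_zero]
  have key : ∀ θ : ℝ, cexp (-(((0 : ℤ) : ℂ) * (θ : ℂ) * I)) * circBase r θ ^ a = circBase r θ ^ a := by
    intro θ; simp
  simp_rw [key]
  exact integral_circBase_cpow hr a


/-- For `|r| < 1` the integrand of `J_a(r, m)` is continuous. [folklore] -/
theorem continuous_coefIntegrand {r : ℝ} (hr : |r| < 1) (a : ℂ) (m : ℤ) :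
    Continuous fun θ : ℝ => cexp (-((m : ℂ) * (θ : ℂ) * I)) * circBase r θ ^ a := by
  refine Continuous.mul (by fun_prop) ?_
  exact (continuous_circBase r).cpow continuous_const (circBase_mem_slitPlane_of_abs_lt hr)

/-- For `|r| < 1`, `θ ↦ (1 - r e^{iθ})^a` is continuous. [folklore] -/
theorem continuous_circBase_cpow {r : ℝ} (hr : |r| < 1) (a : ℂ) :
    Continuous fun θ : ℝ => circBase r θ ^ a :=
  (continuous_circBase r).cpow continuous_const (circBase_mem_slitPlane_of_abs_lt hr)

/-- The derivative of `θ ↦ (1 - r e^{iθ})^{1/2}` for `|r| < 1`: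
`(1/2) (1 - r e^{iθ})^{-1/2} · (-i r e^{iθ})`. [folklore] -/
theorem hasDerivAt_circBase_cpow_half {r : ℝ} (hr : |r| < 1) (θ : ℝ) :
    HasDerivAt (fun x : ℝ => circBase r x ^ (1 / 2 : ℂ))
      ((1 / 2 : ℂ) * circBase r θ ^ (-(1 / 2 : ℂ)) * (-(r * (cexp (θ * I) * I)))) θ := by
  have h := (Complex.hasStrictDerivAt_cpow_const (c := (1 / 2 : ℂ))
    (circBase_mem_slitPlane_of_abs_lt hr θ)).hasDerivAt.comp θ (hasDerivAt_circBase r θ)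
  rw [show (1 / 2 : ℂ) - 1 = -(1 / 2 : ℂ) by norm_num] at h
  exact h

/-- The derivative of `θ ↦ e^{-imθ}/(-im)` is `e^{-imθ}` (`m ≠ 0`). [folklore] -/
theorem hasDerivAt_cexp_neg_int_mul_div {m : ℤ} (hm : m ≠ 0) (θ : ℝ) :
    HasDerivAt (fun x : ℝ => cexp (-((m : ℂ) * (x : ℂ) * I)) / (-((m : ℂ) * I)))
      (cexp (-((m : ℂ) * (θ : ℂ) * I))) θ := by
  have hmI : (-((m : ℂ) * I)) ≠ 0 := by
    simp [hm, I_ne_zero]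
  have h1 : HasDerivAt (fun x : ℝ => -((m : ℂ) * (x : ℂ) * I)) (-((m : ℂ) * 1 * I)) θ := by
    exact (((hasDerivAt_id θ).ofReal_comp.const_mul (m : ℂ)).mul_const I).neg
  have h2 := h1.cexp.div_const (-((m : ℂ) * I))
  have key : cexp (-((m : ℂ) * (θ : ℂ) * I)) * -((m : ℂ) * 1 * I) / -((m : ℂ) * I) =
      cexp (-((m : ℂ) * (θ : ℂ) * I)) := by
    rw [mul_one, mul_div_assoc, div_self hmI, mul_one]
  rw [key] at h2
  exact h2

/-- **Integration by parts on the circle**: for `|r| < 1` and `m ≠ 0`,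
`J_{1/2}(r, m) = -(r/(2m)) J_{-1/2}(r, m - 1)`. [folklore] -/
theorem coefInt_half_eq {r : ℝ} (hr : |r| < 1) {m : ℤ} (hm : m ≠ 0) :
    coefInt (1 / 2 : ℂ) r m = -((r : ℂ) / (2 * m)) * coefInt (-(1 / 2 : ℂ)) r (m - 1) := by
  have hmI : (-((m : ℂ) * I)) ≠ 0 := by simp [hm, I_ne_zero]
  have hm' : (m : ℂ) ≠ 0 := by exact_mod_cast hm
  -- `u = (1 - r e^{iθ})^{1/2}`, `v = e^{-imθ}/(-im)`
  have hparts := intervalIntegral.integral_mul_deriv_eq_deriv_mul (a := -π) (b := π)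
    (u := fun x : ℝ => circBase r x ^ (1 / 2 : ℂ))
    (u' := fun θ : ℝ => (1 / 2 : ℂ) * circBase r θ ^ (-(1 / 2 : ℂ)) * (-(r * (cexp (θ * I) * I))))
    (v := fun x : ℝ => cexp (-((m : ℂ) * (x : ℂ) * I)) / (-((m : ℂ) * I)))
    (v' := fun θ : ℝ => cexp (-((m : ℂ) * (θ : ℂ) * I)))
    (fun θ _ => hasDerivAt_circBase_cpow_half hr θ) (fun θ _ => hasDerivAt_cexp_neg_int_mul_div hm θ)
    ((Continuous.mul (Continuous.mul continuous_const (continuous_circBase_cpow hr _))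
      (by fun_prop)).intervalIntegrable _ _)
    ((by fun_prop : Continuous fun θ : ℝ => cexp (-((m : ℂ) * (θ : ℂ) * I))).intervalIntegrable _ _)
  -- the boundary terms cancel by periodicity
  have hb1 : circBase r π = circBase r (-π) := by
    have := circBase_add_two_pi r (-π)
    rw [show -π + 2 * π = π by ring] at this
    exact this
  have hb2 : cexp (-((m : ℂ) * ((π : ℝ) : ℂ) * I)) = cexp (-((m : ℂ) * ((-π : ℝ) : ℂ) * I)) := by
    have := cexp_neg_int_mul_add_two_pi m (-π)
    rw [show -π + 2 * π = π by ring] at this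
    exact this
  have hbd : circBase r π ^ (1 / 2 : ℂ) * (cexp (-((m : ℂ) * ((π : ℝ) : ℂ) * I)) / (-((m : ℂ) * I))) -
      circBase r (-π) ^ (1 / 2 : ℂ) * (cexp (-((m : ℂ) * ((-π : ℝ) : ℂ) * I)) / (-((m : ℂ) * I))) = 0 := by
    rw [hb1, hb2, sub_self]
  -- identify the two integrals
  have hL : coefInt (1 / 2 : ℂ) r m =
      ∫ x in (-π)..π, circBase r x ^ (1 / 2 : ℂ) * cexp (-((m : ℂ) * (x : ℂ) * I)) := by
    unfold coefInt
    exact intervalIntegral.integral_congr fun θ _ => by ring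
  have hR : ∫ x in (-π)..π, (1 / 2 : ℂ) * circBase r x ^ (-(1 / 2 : ℂ)) * (-(r * (cexp (x * I) * I))) *
      (cexp (-((m : ℂ) * (x : ℂ) * I)) / (-((m : ℂ) * I))) =
      ((r : ℂ) / (2 * m)) * coefInt (-(1 / 2 : ℂ)) r (m - 1) := by
    unfold coefInt
    rw [← intervalIntegral.integral_const_mul]
    refine intervalIntegral.integral_congr fun θ _ => ?_
    have he : cexp (-(((m - 1 : ℤ) : ℂ) * (θ : ℂ) * I)) = cexp (-((m : ℂ) * (θ : ℂ) * I)) * cexp (θ * I) := by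
      rw [← Complex.exp_add]; push_cast; ring_nf
    rw [he]
    field_simp
  rw [hL, hparts, hbd, zero_sub, hR]
  ring

/-- **The algebraic identity** `x^{-1/2} - x^{1/2} = x^{-1/2}(1 - x)` with `1 - b_r(θ) = r e^{iθ}`:
`J_{-1/2}(r, m) - J_{1/2}(r, m) = r J_{-1/2}(r, m - 1)` for `|r| < 1`. [folklore] -/
theorem coefInt_neg_half_sub_half {r : ℝ} (hr : |r| < 1) (m : ℤ) :
    coefInt (-(1 / 2 : ℂ)) r m - coefInt (1 / 2 : ℂ) r m = (r : ℂ) * coefInt (-(1 / 2 : ℂ)) r (m - 1) := by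
  unfold coefInt
  rw [← intervalIntegral.integral_sub ((continuous_coefIntegrand hr _ m).intervalIntegrable _ _)
    ((continuous_coefIntegrand hr _ m).intervalIntegrable _ _), ← intervalIntegral.integral_const_mul]
  refine intervalIntegral.integral_congr fun θ _ => ?_
  have hB : circBase r θ ≠ 0 := slitPlane_ne_zero (circBase_mem_slitPlane_of_abs_lt hr θ)
  have h1 : circBase r θ ^ (1 / 2 : ℂ) = circBase r θ ^ (-(1 / 2 : ℂ)) * circBase r θ := by
    have h := cpow_add (-(1 / 2 : ℂ)) 1 hB
    rw [cpow_one, show -(1 / 2 : ℂ) + 1 = 1 / 2 by norm_num] at h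
    exact h
  have h2 : 1 - circBase r θ = r * cexp (θ * I) := by simp [circBase]
  have he : cexp (-(((m - 1 : ℤ) : ℂ) * (θ : ℂ) * I)) = cexp (-((m : ℂ) * (θ : ℂ) * I)) * cexp (θ * I) := by
    rw [← Complex.exp_add]; push_cast; ring_nf
  rw [h1, he]
  have : cexp (-((m : ℂ) * (θ : ℂ) * I)) * circBase r θ ^ (-(1 / 2 : ℂ)) -
      cexp (-((m : ℂ) * (θ : ℂ) * I)) * (circBase r θ ^ (-(1 / 2 : ℂ)) * circBase r θ) =
      cexp (-((m : ℂ) * (θ : ℂ) * I)) * circBase r θ ^ (-(1 / 2 : ℂ)) * (1 - circBase r θ) := by ring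
  rw [this, h2]; ring


/-! ### Part A, continued: the passage to the boundary `r → 1⁻` -/

/-- `b_r(θ)` in Cartesian form. [folklore] -/
theorem circBase_eq_add_mul_I (r θ : ℝ) :
    circBase r θ = ((1 - r * Real.cos θ : ℝ) : ℂ) + ((-(r * Real.sin θ) : ℝ) : ℂ) * I := by
  unfold circBase
  rw [Complex.exp_mul_I, ← ofReal_cos, ← ofReal_sin]
  push_cast
  ring

/-- `‖b_r(θ)‖² = 1 - 2 r cos θ + r²`. [folklore] -/
theorem norm_circBase_sq (r θ : ℝ) : ‖circBase r θ‖ ^ 2 = 1 - 2 * r * Real.cos θ + r ^ 2 := by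
  rw [← normSq_eq_norm_sq, circBase_eq_add_mul_I, normSq_add_mul_I]
  nlinarith [Real.sin_sq_add_cos_sq θ]

/-- `‖b_1(θ)‖ = 2 |sin(θ/2)|`, i.e. `|1 - e^{iθ}| = 2|sin(θ/2)|`. [folklore] -/
theorem norm_circBase_one (θ : ℝ) : ‖circBase 1 θ‖ = 2 * |Real.sin (θ / 2)| := by
  have h : circBase 1 θ = -(cexp (I * θ) - 1) := by simp [circBase, mul_comm]
  rw [h, norm_neg, Complex.norm_exp_I_mul_ofReal_sub_one]
  simp

/-- Jordan's inequality in the form `2 (θ/π)² ≤ 1 - cos θ` for `|θ| ≤ π`. [folklore] -/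
theorem two_mul_sq_div_pi_le_one_sub_cos {θ : ℝ} (hθ : |θ| ≤ π) :
    2 * (θ / π) ^ 2 ≤ 1 - Real.cos θ := by
  have hπ := Real.pi_pos
  have h1 : 1 - Real.cos θ = 2 * Real.sin (θ / 2) ^ 2 := by
    have := Real.cos_sq (θ / 2)
    rw [show 2 * (θ / 2) = θ by ring] at this
    nlinarith [Real.sin_sq_add_cos_sq (θ / 2)]
  have h2 : |θ| / π ≤ |Real.sin (θ / 2)| := by
    have hs : Real.sin (|θ| / 2) = |Real.sin (θ / 2)| := by
      rcases le_or_gt 0 θ with h | h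
      · have hθ' : θ ≤ π := by rwa [abs_of_nonneg h] at hθ
        rw [abs_of_nonneg h, abs_of_nonneg]
        exact Real.sin_nonneg_of_nonneg_of_le_pi (by positivity) (by linarith)
      · rw [abs_of_neg h, abs_of_nonpos, ← Real.sin_neg]
        · congr 1; ring
        · have : Real.sin (-(θ / 2)) ≥ 0 :=
            Real.sin_nonneg_of_nonneg_of_le_pi (by linarith) (by linarith [abs_of_neg h ▸ hθ])
          rw [Real.sin_neg] at this; linarith
    rw [← hs]
    have := Real.mul_le_sin (x := |θ| / 2) (by positivity) (by linarith)
    calc |θ| / π = 2 / π * (|θ| / 2) := by field_simp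
      _ ≤ Real.sin (|θ| / 2) := this
  have h3 : (θ / π) ^ 2 ≤ Real.sin (θ / 2) ^ 2 := by
    have : (θ / π) ^ 2 = (|θ| / π) ^ 2 := by rw [div_pow, div_pow, sq_abs]
    rw [this, ← sq_abs (Real.sin _)]
    exact pow_le_pow_left₀ (by positivity) h2 2
  linarith

/-- For `r ∈ [1/2, 1]` and `|θ| ≤ π`: `‖b_r(θ)‖ ≥ |θ|/π`. [folklore] -/
theorem abs_div_pi_le_norm_circBase {r θ : ℝ} (hr : 1 / 2 ≤ r) (hr1 : r ≤ 1) (hθ : |θ| ≤ π) :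
    |θ| / π ≤ ‖circBase r θ‖ := by
  have hπ := Real.pi_pos
  have hsq : (|θ| / π) ^ 2 ≤ ‖circBase r θ‖ ^ 2 := by
    rw [norm_circBase_sq, div_pow, sq_abs, ← div_pow]
    have h1 := two_mul_sq_div_pi_le_one_sub_cos hθ
    have h2 : 0 ≤ (θ / π) ^ 2 := sq_nonneg _
    nlinarith
  exact (pow_le_pow_iff_left₀ (by positivity) (norm_nonneg _) two_ne_zero).1 hsq

/-- The exponent `-1/2` is a real number. [folklore] -/
theorem neg_half_eq_ofReal : (-(1 / 2 : ℂ)) = ((-(1 / 2 : ℝ) : ℝ) : ℂ) := by push_cast; ring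

/-- The exponent `1/2` is a real number. [folklore] -/
theorem half_eq_ofReal : (1 / 2 : ℂ) = (((1 / 2 : ℝ)) : ℂ) := by push_cast; ring

/-- `‖e^{-imθ}‖ = 1`. [folklore] -/
theorem norm_cexp_neg_int_mul (m : ℤ) (θ : ℝ) : ‖cexp (-((m : ℂ) * (θ : ℂ) * I))‖ = 1 := by
  rw [show -((m : ℂ) * (θ : ℂ) * I) = ((-(m * θ) : ℝ) : ℂ) * I by push_cast; ring]
  exact Complex.norm_exp_ofReal_mul_I _

/-- The dominating function `(|θ|/π)^{-1/2}` for the `-1/2` power, valid for `r ∈ [1/2, 1]`,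
`0 < |θ| ≤ π`. [folklore] -/
theorem norm_coefIntegrand_neg_half_le {r θ : ℝ} (hr : 1 / 2 ≤ r) (hr1 : r ≤ 1) (hθ : |θ| ≤ π)
    (h0 : θ ≠ 0) (m : ℤ) :
    ‖cexp (-((m : ℂ) * (θ : ℂ) * I)) * circBase r θ ^ (-(1 / 2 : ℂ))‖ ≤ (|θ| / π) ^ (-(1 / 2 : ℝ)) := by
  rw [norm_mul, norm_cexp_neg_int_mul, one_mul, neg_half_eq_ofReal, norm_cpow_real]
  have hpos : 0 < |θ| / π := div_pos (abs_pos.2 h0) Real.pi_pos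
  exact Real.rpow_le_rpow_of_nonpos hpos (abs_div_pi_le_norm_circBase hr hr1 hθ) (by norm_num)

/-- The dominating constant `2` for the `1/2` power, valid for `|r| ≤ 1`. [folklore] -/
theorem norm_coefIntegrand_half_le {r : ℝ} (hr : |r| ≤ 1) (θ : ℝ) (m : ℤ) :
    ‖cexp (-((m : ℂ) * (θ : ℂ) * I)) * circBase r θ ^ (1 / 2 : ℂ)‖ ≤ 2 := by
  rw [norm_mul, norm_cexp_neg_int_mul, one_mul, half_eq_ofReal, norm_cpow_real]
  have h1 : ‖circBase r θ‖ ≤ 4 := by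
    unfold circBase
    calc ‖(1 : ℂ) - r * cexp (θ * I)‖ ≤ ‖(1 : ℂ)‖ + ‖(r : ℂ) * cexp (θ * I)‖ := norm_sub_le _ _
      _ = 1 + |r| := by rw [norm_one, norm_mul, Complex.norm_exp_ofReal_mul_I, mul_one, Complex.norm_real,
          Real.norm_eq_abs]
      _ ≤ 4 := by linarith
  calc ‖circBase r θ‖ ^ (1 / 2 : ℝ) ≤ (4 : ℝ) ^ (1 / 2 : ℝ) :=
        Real.rpow_le_rpow (norm_nonneg _) h1 (by norm_num)
    _ = 2 := by
        rw [show (4 : ℝ) = 2 ^ (2 : ℝ) by norm_num, ← Real.rpow_mul (by norm_num)]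
        norm_num

/-- `θ ↦ |θ|^s` is interval integrable for `s > -1`. [folklore] -/
theorem intervalIntegrable_abs_rpow {s : ℝ} (hs : -1 < s) (a b : ℝ) :
    IntervalIntegrable (fun θ : ℝ => |θ| ^ s) volume a b := by
  suffices h : ∀ c : ℝ, IntervalIntegrable (fun θ : ℝ => |θ| ^ s) volume 0 c from
    (h a).symm.trans (h b)
  have hpos : ∀ c : ℝ, 0 ≤ c → IntervalIntegrable (fun θ : ℝ => |θ| ^ s) volume 0 c := by
    intro c hc
    refine (intervalIntegral.intervalIntegrable_rpow' hs (a := 0) (b := c)).congr_uIoo ?_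
    intro x hx
    rw [uIoo_of_le hc] at hx
    simp [abs_of_pos hx.1]
  intro c
  rcases le_total 0 c with hc | hc
  · exact hpos c hc
  · rw [IntervalIntegrable.iff_comp_neg, neg_zero]
    simpa only [abs_neg] using hpos (-c) (by linarith)

/-- The dominating function `(|θ|/π)^{-1/2}` is interval integrable. [folklore] -/
theorem intervalIntegrable_bound_neg_half (a b : ℝ) :
    IntervalIntegrable (fun θ : ℝ => (|θ| / π) ^ (-(1 / 2 : ℝ))) volume a b := by
  have h := (intervalIntegrable_abs_rpow (by norm_num : (-1 : ℝ) < -(1 / 2)) a b).div_const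
    (π ^ (-(1 / 2 : ℝ)))
  refine h.congr fun θ _ => ?_
  rw [Real.div_rpow (abs_nonneg θ) Real.pi_pos.le]

/-- The integrand of `J_a(r, m)` is measurable in `θ`. [folklore] -/
theorem measurable_coefIntegrand (a : ℂ) (r : ℝ) (m : ℤ) :
    Measurable fun θ : ℝ => cexp (-((m : ℂ) * (θ : ℂ) * I)) * circBase r θ ^ a := by
  refine Measurable.mul (by fun_prop) ?_
  exact (continuous_circBase r).measurable.pow_const a

/-- Almost every real number is nonzero. [folklore] -/
theorem ae_ne_zero : ∀ᵐ θ : ℝ ∂volume, θ ≠ 0 := by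
  rw [ae_iff]
  have : {a : ℝ | ¬a ≠ 0} = {0} := by ext x; simp
  rw [this]
  exact measure_singleton 0

/-- Pointwise convergence of the integrand as `r → 1⁻`, for `θ ∈ (-π, π]`, `θ ≠ 0`. [folklore] -/
theorem tendsto_coefIntegrand {θ : ℝ} (hθ : θ ∈ Ioc (-π) π) (h0 : θ ≠ 0) (a : ℂ) (m : ℤ) :
    Tendsto (fun r : ℝ => cexp (-((m : ℂ) * (θ : ℂ) * I)) * circBase r θ ^ a) (𝓝[<] 1)
      (𝓝 (cexp (-((m : ℂ) * (θ : ℂ) * I)) * circBase 1 θ ^ a)) := by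
  refine Tendsto.const_mul _ ?_
  have h1 : Tendsto (fun r : ℝ => circBase r θ) (𝓝[<] 1) (𝓝 (circBase 1 θ)) :=
    ((continuous_circBase_left θ).tendsto 1).mono_left nhdsWithin_le_nhds
  exact ((continuousAt_cpow_const (b := a) (circBase_one_mem_slitPlane hθ h0)).tendsto).comp h1

/-- **Dominated convergence**: `J_{-1/2}(r, m) → J_{-1/2}(1, m)` as `r → 1⁻`. [folklore] -/
theorem tendsto_coefInt_neg_half (m : ℤ) :
    Tendsto (fun r : ℝ => coefInt (-(1 / 2 : ℂ)) r m) (𝓝[<] 1) (𝓝 (coefInt (-(1 / 2 : ℂ)) 1 m)) := by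
  unfold coefInt
  refine intervalIntegral.tendsto_integral_filter_of_dominated_convergence
    (fun θ => (|θ| / π) ^ (-(1 / 2 : ℝ))) ?_ ?_ (intervalIntegrable_bound_neg_half _ _) ?_
  · exact Eventually.of_forall fun r => (measurable_coefIntegrand _ r m).aestronglyMeasurable
  · filter_upwards [Ico_mem_nhdsLT (by norm_num : (1 / 2 : ℝ) < 1)] with r hr
    filter_upwards [ae_ne_zero] with θ h0 hθ
    rw [uIoc_of_le (by linarith [Real.pi_pos])] at hθ
    exact norm_coefIntegrand_neg_half_le hr.1 hr.2.le (abs_le.2 ⟨hθ.1.le, hθ.2⟩) h0 m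
  · filter_upwards [ae_ne_zero] with θ h0 hθ
    rw [uIoc_of_le (by linarith [Real.pi_pos])] at hθ
    exact tendsto_coefIntegrand hθ h0 _ m

/-- **Dominated convergence**: `J_{1/2}(r, m) → J_{1/2}(1, m)` as `r → 1⁻`. [folklore] -/
theorem tendsto_coefInt_half (m : ℤ) :
    Tendsto (fun r : ℝ => coefInt (1 / 2 : ℂ) r m) (𝓝[<] 1) (𝓝 (coefInt (1 / 2 : ℂ) 1 m)) := by
  unfold coefInt
  refine intervalIntegral.tendsto_integral_filter_of_dominated_convergence
    (fun _ => 2) ?_ ?_ intervalIntegrable_const ?_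
  · exact Eventually.of_forall fun r => (measurable_coefIntegrand _ r m).aestronglyMeasurable
  · filter_upwards [Ico_mem_nhdsLT (by norm_num : (1 / 2 : ℝ) < 1)] with r hr
    refine Eventually.of_forall fun θ _ => norm_coefIntegrand_half_le ?_ θ m
    rw [abs_le]; constructor <;> linarith [hr.1, hr.2]
  · filter_upwards [ae_ne_zero] with θ h0 hθ
    rw [uIoc_of_le (by linarith [Real.pi_pos])] at hθ
    exact tendsto_coefIntegrand hθ h0 _ m

/-! ### Part A, conclusion: the boundary coefficients at `r = 1` -/

/-- `c_m := (1/2π) ∫_{-π}^{π} e^{-imθ} (1 - e^{iθ})^{-1/2} dθ` — the `m`-th Taylor coefficient of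
`(1 - w)^{-1/2}` read off on the unit circle. [folklore] -/
def tipCoeff (m : ℤ) : ℂ := (1 / (2 * π) : ℂ) * coefInt (-(1 / 2 : ℂ)) 1 m

/-- `d_m := (1/2π) ∫_{-π}^{π} e^{-imθ} (1 - e^{iθ})^{1/2} dθ` — the `m`-th Taylor coefficient of
`(1 - w)^{1/2}` read off on the unit circle. [folklore] -/
def sqrtCoeff (m : ℤ) : ℂ := (1 / (2 * π) : ℂ) * coefInt (1 / 2 : ℂ) 1 m

/-- `|r| < 1` eventually along `r → 1⁻`, with `r ∈ [1/2, 1)`. [folklore] -/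
theorem eventually_abs_lt_one : ∀ᶠ r : ℝ in 𝓝[<] 1, |r| < 1 ∧ 1 / 2 ≤ r := by
  filter_upwards [Ico_mem_nhdsLT (by norm_num : (1 / 2 : ℝ) < 1)] with r hr
  exact ⟨by rw [abs_lt]; constructor <;> linarith [hr.1, hr.2], hr.1⟩

/-- `J_{-1/2}(1, m) = 0` for `m ≤ -1`. [folklore] -/
theorem coefInt_neg_half_one_of_neg {m : ℤ} (hm : m ≤ -1) : coefInt (-(1 / 2 : ℂ)) 1 m = 0 := by
  refine tendsto_nhds_unique (tendsto_coefInt_neg_half m) ?_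
  refine (tendsto_congr' ?_).1 tendsto_const_nhds
  filter_upwards [eventually_abs_lt_one] with r hr
  exact (coefInt_eq_zero_of_neg hr.1 _ hm).symm

/-- `J_{1/2}(1, m) = 0` for `m ≤ -1`. [folklore] -/
theorem coefInt_half_one_of_neg {m : ℤ} (hm : m ≤ -1) : coefInt (1 / 2 : ℂ) 1 m = 0 := by
  refine tendsto_nhds_unique (tendsto_coefInt_half m) ?_
  refine (tendsto_congr' ?_).1 tendsto_const_nhds
  filter_upwards [eventually_abs_lt_one] with r hr
  exact (coefInt_eq_zero_of_neg hr.1 _ hm).symm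

/-- `J_{-1/2}(1, 0) = 2π`. [folklore] -/
theorem coefInt_neg_half_one_zero : coefInt (-(1 / 2 : ℂ)) 1 0 = 2 * π := by
  refine tendsto_nhds_unique (tendsto_coefInt_neg_half 0) ?_
  refine (tendsto_congr' ?_).1 tendsto_const_nhds
  filter_upwards [eventually_abs_lt_one] with r hr
  exact (coefInt_zero hr.1 _).symm

/-- `J_{1/2}(1, 0) = 2π`. [folklore] -/
theorem coefInt_half_one_zero : coefInt (1 / 2 : ℂ) 1 0 = 2 * π := by
  refine tendsto_nhds_unique (tendsto_coefInt_half 0) ?_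
  refine (tendsto_congr' ?_).1 tendsto_const_nhds
  filter_upwards [eventually_abs_lt_one] with r hr
  exact (coefInt_zero hr.1 _).symm

/-- At `r = 1`: `J_{1/2}(1, m) = -(1/(2m)) J_{-1/2}(1, m - 1)` for `m ≠ 0`. [folklore] -/
theorem coefInt_half_one_eq {m : ℤ} (hm : m ≠ 0) :
    coefInt (1 / 2 : ℂ) 1 m = -((1 : ℂ) / (2 * m)) * coefInt (-(1 / 2 : ℂ)) 1 (m - 1) := by
  refine tendsto_nhds_unique (tendsto_coefInt_half m) ?_
  have h : Tendsto (fun r : ℝ => -((r : ℂ) / (2 * m)) * coefInt (-(1 / 2 : ℂ)) r (m - 1)) (𝓝[<] 1)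
      (𝓝 (-(((1 : ℝ) : ℂ) / (2 * m)) * coefInt (-(1 / 2 : ℂ)) 1 (m - 1))) := by
    refine Tendsto.mul ?_ (tendsto_coefInt_neg_half (m - 1))
    refine Tendsto.neg (Tendsto.div_const ?_ _)
    exact (continuous_ofReal.tendsto 1).mono_left nhdsWithin_le_nhds
  rw [ofReal_one] at h
  refine (tendsto_congr' ?_).1 h
  filter_upwards [eventually_abs_lt_one] with r hr
  exact (coefInt_half_eq hr.1 hm).symm

/-- At `r = 1`: `J_{-1/2}(1, m) - J_{1/2}(1, m) = J_{-1/2}(1, m - 1)`. [folklore] -/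
theorem coefInt_neg_half_sub_half_one (m : ℤ) :
    coefInt (-(1 / 2 : ℂ)) 1 m - coefInt (1 / 2 : ℂ) 1 m = coefInt (-(1 / 2 : ℂ)) 1 (m - 1) := by
  have h1 : Tendsto (fun r : ℝ => coefInt (-(1 / 2 : ℂ)) r m - coefInt (1 / 2 : ℂ) r m) (𝓝[<] 1)
      (𝓝 (coefInt (-(1 / 2 : ℂ)) 1 m - coefInt (1 / 2 : ℂ) 1 m)) :=
    (tendsto_coefInt_neg_half m).sub (tendsto_coefInt_half m)
  have h2 : Tendsto (fun r : ℝ => (r : ℂ) * coefInt (-(1 / 2 : ℂ)) r (m - 1)) (𝓝[<] 1)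
      (𝓝 (((1 : ℝ) : ℂ) * coefInt (-(1 / 2 : ℂ)) 1 (m - 1))) :=
    ((continuous_ofReal.tendsto 1).mono_left nhdsWithin_le_nhds).mul (tendsto_coefInt_neg_half (m - 1))
  rw [ofReal_one, one_mul] at h2
  refine tendsto_nhds_unique h1 ((tendsto_congr' ?_).1 h2)
  filter_upwards [eventually_abs_lt_one] with r hr
  exact (coefInt_neg_half_sub_half hr.1 m).symm

/-- `c_m = 0` for `m ≤ -1`. [folklore] -/
theorem tipCoeff_of_neg {m : ℤ} (hm : m ≤ -1) : tipCoeff m = 0 := by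
  rw [tipCoeff, coefInt_neg_half_one_of_neg hm, mul_zero]

/-- `d_m = 0` for `m ≤ -1`. [folklore] -/
theorem sqrtCoeff_of_neg {m : ℤ} (hm : m ≤ -1) : sqrtCoeff m = 0 := by
  rw [sqrtCoeff, coefInt_half_one_of_neg hm, mul_zero]

/-- `c_0 = 1`. [folklore] -/
theorem tipCoeff_zero : tipCoeff 0 = 1 := by
  rw [tipCoeff, coefInt_neg_half_one_zero]
  have : (π : ℂ) ≠ 0 := by exact_mod_cast Real.pi_ne_zero
  field_simp

/-- `d_0 = 1`. [folklore] -/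
theorem sqrtCoeff_zero : sqrtCoeff 0 = 1 := by
  rw [sqrtCoeff, coefInt_half_one_zero]
  have : (π : ℂ) ≠ 0 := by exact_mod_cast Real.pi_ne_zero
  field_simp

/-- `d_m = -c_{m-1}/(2m)` for `m ≠ 0`. [folklore] -/
theorem sqrtCoeff_eq {m : ℤ} (hm : m ≠ 0) : sqrtCoeff m = -((1 : ℂ) / (2 * m)) * tipCoeff (m - 1) := by
  rw [sqrtCoeff, tipCoeff, coefInt_half_one_eq hm]
  ring

/-- **The Wallis recurrence** `c_m = c_{m-1} (2m - 1)/(2m)` for `m ≠ 0`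
(from `c_m - d_m = c_{m-1}` and `d_m = -c_{m-1}/(2m)`). [folklore] -/
theorem tipCoeff_eq {m : ℤ} (hm : m ≠ 0) : tipCoeff m = tipCoeff (m - 1) * ((2 * m - 1) / (2 * m)) := by
  have h1 : tipCoeff m - sqrtCoeff m = tipCoeff (m - 1) := by
    rw [tipCoeff, sqrtCoeff, tipCoeff, ← mul_sub, coefInt_neg_half_sub_half_one]
  rw [sqrtCoeff_eq hm] at h1
  have hm' : (m : ℂ) ≠ 0 := by exact_mod_cast hm
  have h2 : tipCoeff m = tipCoeff (m - 1) - (1 : ℂ) / (2 * m) * tipCoeff (m - 1) := by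
    linear_combination h1
  rw [h2]
  field_simp

/-- **`c_m = binom(2m, m)/4^m`** for `m ≥ 0`: the Taylor coefficients of `(1 - w)^{-1/2}`.
[folklore] -/
theorem tipCoeff_natCast (m : ℕ) : tipCoeff m = (m.centralBinom : ℂ) / 4 ^ m := by
  induction m with
  | zero => simp [tipCoeff_zero, Nat.centralBinom_zero]
  | succ n ih =>
    have hne : ((n + 1 : ℕ) : ℤ) ≠ 0 := by omega
    rw [tipCoeff_eq hne]
    rw [show ((n + 1 : ℕ) : ℤ) - 1 = (n : ℤ) by push_cast; ring, ih]
    have hrec := Nat.succ_mul_centralBinom_succ n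
    have hrec' : ((n + 1 : ℕ) : ℂ) * ((n + 1).centralBinom : ℂ) =
        2 * (2 * (n : ℂ) + 1) * (n.centralBinom : ℂ) := by exact_mod_cast hrec
    have hn1 : ((n : ℂ) + 1) ≠ 0 := by exact_mod_cast Nat.succ_ne_zero n
    push_cast
    field_simp
    push_cast at hrec'
    linear_combination (-2 : ℂ) * 4 ^ n * hrec'


/-! ### Part B. The slit-plane kernel `K(k, s)` -/

/-- **The Wiener–Hopf factor** `ĝ(t) = (1 - e^{2it})^{-1/2}` (principal branch; junk `0` at
`t ∈ πℤ`). [folklore] -/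
def slitGHat (t : ℝ) : ℂ := circBase 1 (2 * t) ^ (-(1 / 2 : ℂ))

/-- `‖1 - e^{2it}‖ = 2|sin t|`. [folklore] -/
theorem norm_circBase_one_two_mul (t : ℝ) : ‖circBase 1 (2 * t)‖ = 2 * |Real.sin t| := by
  rw [norm_circBase_one, show 2 * t / 2 = t by ring]

/-- `‖ĝ(t)‖ = (2|sin t|)^{-1/2}`. [folklore] -/
theorem norm_slitGHat (t : ℝ) : ‖slitGHat t‖ = (2 * |Real.sin t|) ^ (-(1 / 2 : ℝ)) := by
  rw [slitGHat, neg_half_eq_ofReal, norm_cpow_real, norm_circBase_one_two_mul]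

/-- `|sin t| = sin |t|` for `|t| ≤ π`. [folklore] -/
theorem abs_sin_eq_sin_abs {t : ℝ} (ht : |t| ≤ π) : |Real.sin t| = Real.sin |t| := by
  rcases le_or_gt 0 t with h | h
  · rw [abs_of_nonneg h] at ht ⊢
    exact abs_of_nonneg (Real.sin_nonneg_of_nonneg_of_le_pi h ht)
  · rw [abs_of_neg h] at ht ⊢
    have hst : 0 ≤ Real.sin (-t) := Real.sin_nonneg_of_nonneg_of_le_pi (by linarith) ht
    rw [show Real.sin t = -Real.sin (-t) by rw [Real.sin_neg, neg_neg], abs_neg, abs_of_nonneg hst]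

/-- Jordan: `|t| ≤ 2|sin t|` for `|t| ≤ π/2`. [folklore] -/
theorem abs_le_two_mul_abs_sin {t : ℝ} (ht : |t| ≤ π / 2) : |t| ≤ 2 * |Real.sin t| := by
  have hπ := Real.pi_pos
  rw [abs_sin_eq_sin_abs (by linarith)]
  have h1 := Real.mul_le_sin (abs_nonneg t) ht
  have h4 := Real.pi_le_four
  have h2 : |t| ≤ 2 * (2 / π * |t|) := by
    rw [show 2 * (2 / π * |t|) = (4 / π) * |t| by ring]
    have : 1 ≤ 4 / π := by rw [le_div_iff₀ hπ]; linarith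
    nlinarith [abs_nonneg t]
  linarith

/-- For `0 < |t| ≤ π/2`: `‖ĝ(t)‖ ≤ |t|^{-1/2}`. [folklore] -/
theorem norm_slitGHat_le {t : ℝ} (ht : |t| ≤ π / 2) (h0 : t ≠ 0) : ‖slitGHat t‖ ≤ |t| ^ (-(1 / 2 : ℝ)) := by
  rw [norm_slitGHat]
  exact Real.rpow_le_rpow_of_nonpos (abs_pos.2 h0) (abs_le_two_mul_abs_sin ht) (by norm_num)

/-- `ĝ` is measurable. [folklore] -/
theorem measurable_slitGHat : Measurable slitGHat := by
  unfold slitGHat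
  exact ((continuous_circBase 1).comp (continuous_const.mul continuous_id)).measurable.pow_const _

/-- The complex integrand `e^{-ikt} ĝ(t)`. [folklore] -/
def slitCFun (k : ℤ) (t : ℝ) : ℂ := cexp (-((k : ℂ) * (t : ℂ) * I)) * slitGHat t

/-- `e^{-ikt} ĝ(t)` is measurable. [folklore] -/
theorem measurable_slitCFun (k : ℤ) : Measurable (slitCFun k) := by
  unfold slitCFun
  exact Measurable.mul (by fun_prop) measurable_slitGHat

/-- `‖e^{-ikt} ĝ(t)‖ ≤ |t|^{-1/2}` for `0 < |t| ≤ π/2`. [folklore] -/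
theorem norm_slitCFun_le (k : ℤ) {t : ℝ} (ht : |t| ≤ π / 2) (h0 : t ≠ 0) :
    ‖slitCFun k t‖ ≤ |t| ^ (-(1 / 2 : ℝ)) := by
  rw [slitCFun, norm_mul, norm_cexp_neg_int_mul, one_mul]
  exact norm_slitGHat_le ht h0

/-- Membership in `Ι (-π/2) (π/2)` gives `|t| ≤ π/2`. [folklore] -/
theorem abs_le_of_mem_uIoc_half_pi {t : ℝ} (ht : t ∈ Ι (-(π / 2)) (π / 2)) : |t| ≤ π / 2 := by
  rw [uIoc_of_le (by linarith [Real.pi_pos])] at ht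
  exact abs_le.2 ⟨ht.1.le, ht.2⟩

/-- `e^{-ikt} ĝ(t)` is interval integrable on `[-π/2, π/2]`. [folklore] -/
theorem intervalIntegrable_slitCFun (k : ℤ) : IntervalIntegrable (slitCFun k) volume (-(π / 2)) (π / 2) := by
  refine (intervalIntegrable_abs_rpow (by norm_num : (-1 : ℝ) < -(1 / 2)) _ _).mono_fun'
    (measurable_slitCFun k).aestronglyMeasurable ?_
  rw [EventuallyLE, ae_restrict_iff' measurableSet_uIoc]
  filter_upwards [ae_ne_zero] with t h0 ht
  exact norm_slitCFun_le k (abs_le_of_mem_uIoc_half_pi ht) h0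

/-- **The kernel integrand** `Re(e^{-ikt} ĝ(t)) · y(t)^s`. [folklore] -/
def slitKerFun (k : ℤ) (s : ℕ) (t : ℝ) : ℝ := (slitCFun k t).re * chmY t ^ s

/-- The kernel integrand is measurable. [folklore] -/
theorem measurable_slitKerFun (k : ℤ) (s : ℕ) : Measurable (slitKerFun k s) := by
  unfold slitKerFun
  exact (Complex.measurable_re.comp (measurable_slitCFun k)).mul (continuous_chmY.measurable.pow_const s)

/-- `|Re(e^{-ikt} ĝ(t)) y(t)^s| ≤ |t|^{-1/2}` for `0 < |t| ≤ π/2`. [folklore] -/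
theorem norm_slitKerFun_le (k : ℤ) (s : ℕ) {t : ℝ} (ht : |t| ≤ π / 2) (h0 : t ≠ 0) :
    ‖slitKerFun k s t‖ ≤ |t| ^ (-(1 / 2 : ℝ)) := by
  rw [slitKerFun, Real.norm_eq_abs, abs_mul, abs_pow]
  have h1 : |(slitCFun k t).re| ≤ |t| ^ (-(1 / 2 : ℝ)) :=
    (abs_re_le_norm _).trans (norm_slitCFun_le k ht h0)
  have h2 : |chmY t| ^ s ≤ 1 := pow_le_one₀ (abs_nonneg _) (abs_chmY_le_one t)
  have h3 : 0 ≤ |t| ^ (-(1 / 2 : ℝ)) := Real.rpow_nonneg (abs_nonneg t) _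
  calc |(slitCFun k t).re| * |chmY t| ^ s ≤ |t| ^ (-(1 / 2 : ℝ)) * 1 :=
        mul_le_mul h1 h2 (pow_nonneg (abs_nonneg _) s) h3
    _ = _ := mul_one _

/-- **Integrability**: the kernel integrand is interval integrable on `[-π/2, π/2]`
(its only singularity, at `t = 0`, is like `|t|^{-1/2}`). [folklore] -/
theorem intervalIntegrable_slitKerFun (k : ℤ) (s : ℕ) :
    IntervalIntegrable (slitKerFun k s) volume (-(π / 2)) (π / 2) := by
  refine (intervalIntegrable_abs_rpow (by norm_num : (-1 : ℝ) < -(1 / 2)) _ _).mono_fun'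
    (measurable_slitKerFun k s).aestronglyMeasurable ?_
  rw [EventuallyLE, ae_restrict_iff' measurableSet_uIoc]
  filter_upwards [ae_ne_zero] with t h0 ht
  exact norm_slitKerFun_le k s (abs_le_of_mem_uIoc_half_pi ht) h0

/-- **The slit-plane kernel**
`K(k, s) = (1/π) ∫_{-π/2}^{π/2} Re(e^{-ikt} (1 - e^{2it})^{-1/2}) y(t)^s dt` — a closed form for the
discrete harmonic measure of the tip of a diagonal slit in `ℤ²` (CHI's `F¹_{[ℂ_δ,a]}`, Lemma 2.14,
in the coordinates `k = a + b`, `s = |a - b|`).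
[cite: ChelkakHonglerIzyurovAnnals2015, Lemma 2.14 and §3.2.2 (F-1-as-hm)] -/
def slitKernel (k : ℤ) (s : ℕ) : ℝ := 1 / π * ∫ t in (-(π / 2))..(π / 2), slitKerFun k s t

/-! ### Harmonicity off the row `s = 0` -/

/-- `e^{-i(k-1)t} + e^{-i(k+1)t} = 2 cos t · e^{-ikt}`. [folklore] -/
theorem cexp_sub_one_add_cexp_add_one (k : ℤ) (t : ℝ) :
    cexp (-(((k - 1 : ℤ) : ℂ) * (t : ℂ) * I)) + cexp (-(((k + 1 : ℤ) : ℂ) * (t : ℂ) * I)) =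
      ((2 * Real.cos t : ℝ) : ℂ) * cexp (-((k : ℂ) * (t : ℂ) * I)) := by
  have h1 : cexp (-(((k - 1 : ℤ) : ℂ) * (t : ℂ) * I)) = cexp (-((k : ℂ) * (t : ℂ) * I)) * cexp (t * I) := by
    rw [← Complex.exp_add]; push_cast; ring_nf
  have h2 : cexp (-(((k + 1 : ℤ) : ℂ) * (t : ℂ) * I)) = cexp (-((k : ℂ) * (t : ℂ) * I)) * cexp (-t * I) := by
    rw [← Complex.exp_add]; push_cast; ring_nf
  rw [h1, h2, ← mul_add, ← Complex.two_cos]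
  push_cast
  rw [← Complex.ofReal_cos]
  ring

/-- `Re(e^{-i(k-1)t} ĝ) + Re(e^{-i(k+1)t} ĝ) = 2 cos t · Re(e^{-ikt} ĝ)`. [folklore] -/
theorem slitCFun_re_sub_one_add (k : ℤ) (t : ℝ) :
    (slitCFun (k - 1) t).re + (slitCFun (k + 1) t).re = 2 * Real.cos t * (slitCFun k t).re := by
  unfold slitCFun
  rw [← Complex.add_re, ← add_mul, cexp_sub_one_add_cexp_add_one, mul_assoc, re_ofReal_mul]

/-- **Harmonicity off the row** (`s ≥ 1`):
`K(k,s) = ¼[K(k-1,s-1) + K(k+1,s-1) + K(k-1,s+1) + K(k+1,s+1)]`, because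
`¼(e^{it} + e^{-it})(y^{s-1} + y^{s+1}) = ½ cos t · y^{s-1}(1 + y²) = y^s`. [folklore] -/
theorem slitKernel_harmonic (k : ℤ) {s : ℕ} (hs : 1 ≤ s) :
    slitKernel k s = 1 / 4 * (slitKernel (k - 1) (s - 1) + slitKernel (k + 1) (s - 1) +
      slitKernel (k - 1) (s + 1) + slitKernel (k + 1) (s + 1)) := by
  obtain ⟨r, rfl⟩ : ∃ r, s = r + 1 := ⟨s - 1, by omega⟩
  simp only [Nat.add_sub_cancel]
  have hpt : ∀ t, slitKerFun k (r + 1) t = 1 / 4 * (slitKerFun (k - 1) r t + slitKerFun (k + 1) r t +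
      slitKerFun (k - 1) (r + 1 + 1) t + slitKerFun (k + 1) (r + 1 + 1) t) := by
    intro t
    simp only [slitKerFun]
    have hy := chmY_eq_half_cos_mul t
    have hc := slitCFun_re_sub_one_add k t
    have key : chmY t ^ (r + 1) = chmY t ^ r * (1 / 2 * Real.cos t * (1 + chmY t ^ 2)) := by
      rw [pow_succ, ← hy]
    have hgrp : (1 : ℝ) / 4 * ((slitCFun (k - 1) t).re * chmY t ^ r + (slitCFun (k + 1) t).re * chmY t ^ r +
        (slitCFun (k - 1) t).re * chmY t ^ (r + 1 + 1) + (slitCFun (k + 1) t).re * chmY t ^ (r + 1 + 1)) =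
        1 / 4 * (((slitCFun (k - 1) t).re + (slitCFun (k + 1) t).re) * (chmY t ^ r * (1 + chmY t ^ 2))) := by
      ring
    rw [hgrp, hc, key]; ring
  have hI := intervalIntegrable_slitKerFun
  unfold slitKernel
  rw [intervalIntegral.integral_congr fun t _ => hpt t, intervalIntegral.integral_const_mul,
    intervalIntegral.integral_add (((hI (k - 1) r).add (hI (k + 1) r)).add (hI (k - 1) (r + 1 + 1)))
      (hI (k + 1) (r + 1 + 1)),
    intervalIntegral.integral_add ((hI (k - 1) r).add (hI (k + 1) r)) (hI (k - 1) (r + 1 + 1)),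
    intervalIntegral.integral_add (hI (k - 1) r) (hI (k + 1) r)]
  ring

/-! ### The row `s = 0`: the Wiener–Hopf identity -/

/-- The row defect of the integrand:
`Re(e^{-ikt}ĝ) - ½[Re(e^{-i(k-1)t}ĝ) y + Re(e^{-i(k+1)t}ĝ) y] = Re(e^{-ikt}ĝ(t)) |sin t|`
(`1 - cos t · y = |sin t|`). [folklore] -/
theorem slitKerFun_row (k : ℤ) (t : ℝ) :
    slitKerFun k 0 t - 1 / 2 * (slitKerFun (k - 1) 1 t + slitKerFun (k + 1) 1 t) =
      (slitCFun k t).re * |Real.sin t| := by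
  simp only [slitKerFun, pow_zero, mul_one, pow_one]
  have hc := slitCFun_re_sub_one_add k t
  have hy := cos_mul_chmY t
  have hgrp : (slitCFun (k - 1) t).re * chmY t + (slitCFun (k + 1) t).re * chmY t =
      ((slitCFun (k - 1) t).re + (slitCFun (k + 1) t).re) * chmY t := by ring
  rw [hgrp, hc]
  have : 2 * Real.cos t * (slitCFun k t).re * chmY t = 2 * (slitCFun k t).re * (Real.cos t * chmY t) := by ring
  rw [this, hy]; ring

/-- `conj(e^{ikt}) = e^{-ikt}`. [folklore] -/
theorem conj_cexp_int_mul (k : ℤ) (t : ℝ) :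
    conj (cexp ((k : ℂ) * (t : ℂ) * I)) = cexp (-((k : ℂ) * (t : ℂ) * I)) := by
  rw [← Complex.exp_conj]
  congr 1
  simp [Complex.conj_ofReal]

/-- **The Wiener–Hopf identity** behind the row structure:
`Re(e^{-ikt} ĝ(t)) · |sin t| = ½ Re(e^{ikt} (1 - e^{2it})^{1/2})`.
Proof: with `w = (1 - e^{2it})^{1/2}` one has `ĝ = w⁻¹` and `|w|² = 2|sin t|`, so
`ĝ |sin t| = ½ conj(w)`; no branch analysis is needed. [folklore] -/
theorem slitCFun_re_mul_abs_sin (k : ℤ) (t : ℝ) :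
    (slitCFun k t).re * |Real.sin t| =
      1 / 2 * (cexp ((k : ℂ) * (t : ℂ) * I) * circBase 1 (2 * t) ^ (1 / 2 : ℂ)).re := by
  by_cases hs : Real.sin t = 0
  · -- both sides vanish
    have hB : circBase 1 (2 * t) = 0 := by
      rw [← norm_eq_zero, norm_circBase_one_two_mul, hs, abs_zero, mul_zero]
    rw [hs, hB, zero_cpow (by norm_num), abs_zero, mul_zero, mul_zero, Complex.zero_re, mul_zero]
  · set B := circBase 1 (2 * t) with hBdef
    set w := B ^ (1 / 2 : ℂ) with hw
    have hBn : ‖B‖ = 2 * |Real.sin t| := norm_circBase_one_two_mul t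
    have hspos : 0 < 2 * |Real.sin t| := by positivity
    have hwn : ‖w‖ ^ 2 = 2 * |Real.sin t| := by
      rw [hw, half_eq_ofReal, norm_cpow_real, ← Real.rpow_natCast, ← Real.rpow_mul (norm_nonneg _)]
      norm_num; exact hBn
    have hw0 : w ≠ 0 := by
      intro h; rw [h, norm_zero] at hwn; simp at hwn; exact hs hwn
    have hg : slitGHat t = w⁻¹ := by rw [slitGHat, ← hBdef, hw, cpow_neg]
    have hinv : w⁻¹ = conj w * (((2 * |Real.sin t|)⁻¹ : ℝ) : ℂ) := by
      rw [Complex.inv_def, normSq_eq_norm_sq, hwn]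
    -- `|sin t| e^{-ikt} ĝ = ½ conj(e^{ikt} w)`
    have key : ((|Real.sin t| : ℝ) : ℂ) * slitCFun k t =
        (((1 / 2 : ℝ)) : ℂ) * conj (cexp ((k : ℂ) * (t : ℂ) * I) * w) := by
      rw [slitCFun, hg, hinv, map_mul, conj_cexp_int_mul]
      have hne : ((|Real.sin t| : ℝ) : ℂ) ≠ 0 := by exact_mod_cast (abs_pos.2 hs).ne'
      push_cast
      field_simp
    have h := congrArg Complex.re key
    rw [re_ofReal_mul, re_ofReal_mul, Complex.conj_re] at h
    rw [mul_comm]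
    exact h


/-! ### The row `s = 0`: values and defects through Part A -/

/-- The boundary integrand of `J_{-1/2}(1, m)` is interval integrable on `[-π, π]`. [folklore] -/
theorem intervalIntegrable_coefIntegrand_neg_half_one (m : ℤ) :
    IntervalIntegrable (fun θ : ℝ => cexp (-((m : ℂ) * (θ : ℂ) * I)) * circBase 1 θ ^ (-(1 / 2 : ℂ)))
      volume (-π) π := by
  refine (intervalIntegrable_bound_neg_half _ _).mono_fun'
    (measurable_coefIntegrand _ 1 m).aestronglyMeasurable ?_
  rw [EventuallyLE, ae_restrict_iff' measurableSet_uIoc]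
  filter_upwards [ae_ne_zero] with θ h0 hθ
  rw [uIoc_of_le (by linarith [Real.pi_pos])] at hθ
  exact norm_coefIntegrand_neg_half_le (by norm_num) le_rfl (abs_le.2 ⟨hθ.1.le, hθ.2⟩) h0 m

/-- The boundary integrand of `J_{1/2}(1, m)` is interval integrable on `[-π, π]`. [folklore] -/
theorem intervalIntegrable_coefIntegrand_half_one (m : ℤ) :
    IntervalIntegrable (fun θ : ℝ => cexp (-((m : ℂ) * (θ : ℂ) * I)) * circBase 1 θ ^ (1 / 2 : ℂ))
      volume (-π) π := by
  refine (intervalIntegrable_const (c := (2 : ℝ))).mono_fun'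
    (measurable_coefIntegrand _ 1 m).aestronglyMeasurable ?_
  exact Eventually.of_forall fun θ => norm_coefIntegrand_half_le (by norm_num) θ m

/-- `(1/(2π)) · z` has real part `(1/(2π)) Re z`. [folklore] -/
theorem re_one_div_two_pi_mul (z : ℂ) : ((1 / (2 * π) : ℂ) * z).re = 1 / (2 * π) * z.re := by
  rw [show (1 / (2 * π) : ℂ) = ((1 / (2 * π) : ℝ) : ℂ) by push_cast; ring, re_ofReal_mul]

/-- **The row values are Taylor coefficients of `(1 - w)^{-1/2}`**: `K(2m, 0) = Re c_m`
(substitution `u = 2t`). [folklore] -/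
theorem slitKernel_two_mul_zero (m : ℤ) : slitKernel (2 * m) 0 = (tipCoeff m).re := by
  set F : ℝ → ℂ := fun u => cexp (-((m : ℂ) * (u : ℂ) * I)) * circBase 1 u ^ (-(1 / 2 : ℂ)) with hF
  have hpt : ∀ t : ℝ, slitKerFun (2 * m) 0 t = (fun u => (F u).re) (2 * t) := by
    intro t
    simp only [slitKerFun, pow_zero, mul_one, slitCFun, slitGHat, hF]
    congr 3
    push_cast; ring_nf
  have hsub : ∫ t in (-(π / 2))..(π / 2), slitKerFun (2 * m) 0 t = 1 / 2 * ∫ u in (-π)..π, (F u).re := by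
    rw [intervalIntegral.integral_congr fun t _ => hpt t,
      intervalIntegral.integral_comp_mul_left (fun u => (F u).re) (two_ne_zero),
      show (2 : ℝ) * (-(π / 2)) = -π by ring, show (2 : ℝ) * (π / 2) = π by ring, smul_eq_mul]
    norm_num
  have hre : ∫ u in (-π)..π, (F u).re = (∫ u in (-π)..π, F u).re := by
    have h := intervalIntegral_re (intervalIntegrable_coefIntegrand_neg_half_one m)
    simpa only [RCLike.re_to_complex] using h
  rw [slitKernel, hsub, hre, tipCoeff, re_one_div_two_pi_mul]
  rw [show (∫ u in (-π)..π, F u) = coefInt (-(1 / 2 : ℂ)) 1 m from rfl]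
  ring

/-- **The row defect is a Taylor coefficient of `(1 - w)^{1/2}`**:
`K(2m,0) - ½[K(2m-1,1) + K(2m+1,1)] = ½ Re d_{-m}`. [folklore] -/
theorem slitKernel_row (m : ℤ) :
    slitKernel (2 * m) 0 - 1 / 2 * (slitKernel (2 * m - 1) 1 + slitKernel (2 * m + 1) 1) =
      1 / 2 * (sqrtCoeff (-m)).re := by
  set F : ℝ → ℂ := fun u => cexp (-(((-m : ℤ) : ℂ) * (u : ℂ) * I)) * circBase 1 u ^ (1 / 2 : ℂ) with hF
  have hI := intervalIntegrable_slitKerFun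
  have hcomb : slitKernel (2 * m) 0 - 1 / 2 * (slitKernel (2 * m - 1) 1 + slitKernel (2 * m + 1) 1) =
      1 / π * ∫ t in (-(π / 2))..(π / 2), (slitKerFun (2 * m) 0 t -
        1 / 2 * (slitKerFun (2 * m - 1) 1 t + slitKerFun (2 * m + 1) 1 t)) := by
    simp only [slitKernel]
    rw [intervalIntegral.integral_sub (hI _ _) (((hI _ _).add (hI _ _)).const_mul _),
      intervalIntegral.integral_const_mul, intervalIntegral.integral_add (hI _ _) (hI _ _)]
    ring
  have hpt : ∀ t : ℝ, slitKerFun (2 * m) 0 t - 1 / 2 * (slitKerFun (2 * m - 1) 1 t + slitKerFun (2 * m + 1) 1 t) =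
      1 / 2 * (fun u => (F u).re) (2 * t) := by
    intro t
    rw [slitKerFun_row, slitCFun_re_mul_abs_sin]
    simp only [hF]
    congr 4
    push_cast; ring_nf
  have hsub : ∫ t in (-(π / 2))..(π / 2), (slitKerFun (2 * m) 0 t -
      1 / 2 * (slitKerFun (2 * m - 1) 1 t + slitKerFun (2 * m + 1) 1 t)) = 1 / 4 * ∫ u in (-π)..π, (F u).re := by
    rw [intervalIntegral.integral_congr fun t _ => hpt t, intervalIntegral.integral_const_mul,
      intervalIntegral.integral_comp_mul_left (fun u => (F u).re) (two_ne_zero),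
      show (2 : ℝ) * (-(π / 2)) = -π by ring, show (2 : ℝ) * (π / 2) = π by ring, smul_eq_mul]
    norm_num; ring
  have hre : ∫ u in (-π)..π, (F u).re = (∫ u in (-π)..π, F u).re := by
    have h := intervalIntegral_re (intervalIntegrable_coefIntegrand_half_one (-m))
    simpa only [RCLike.re_to_complex] using h
  rw [hcomb, hsub, hre, sqrtCoeff, re_one_div_two_pi_mul]
  rw [show (∫ u in (-π)..π, F u) = coefInt (1 / 2 : ℂ) 1 (-m) from rfl]
  ring

/-- **Values on the positive row**: `K(2m, 0) = binom(2m, m)/4^m` for `m ∈ ℕ` — in particular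
`K(0, 0) = 1`. [folklore] -/
theorem slitKernel_two_mul_natCast_zero (m : ℕ) : slitKernel (2 * m) 0 = (m.centralBinom : ℝ) / 4 ^ m := by
  rw [slitKernel_two_mul_zero, tipCoeff_natCast]
  rw [show ((m.centralBinom : ℂ) / 4 ^ m) = (((m.centralBinom : ℝ) / 4 ^ m : ℝ) : ℂ) by push_cast; ring,
    ofReal_re]

/-- `K(0, 0) = 1`. [folklore] -/
theorem slitKernel_zero_zero : slitKernel 0 0 = 1 := by
  have h := slitKernel_two_mul_natCast_zero 0
  simpa using h

/-- **The kernel vanishes on the slit**: `K(2m, 0) = 0` for `m ≤ -1`. [folklore] -/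
theorem slitKernel_two_mul_zero_of_neg {m : ℤ} (hm : m ≤ -1) : slitKernel (2 * m) 0 = 0 := by
  rw [slitKernel_two_mul_zero, tipCoeff_of_neg hm, Complex.zero_re]

/-- **Harmonicity on the positive row**: `K(2m, 0) = ½[K(2m-1, 1) + K(2m+1, 1)]` for `m ≥ 1`
(with the symmetric extension in `s`, this is the four-point mean value property at `(2m, 0)`).
[folklore] -/
theorem slitKernel_row_of_pos {m : ℤ} (hm : 1 ≤ m) :
    slitKernel (2 * m) 0 = 1 / 2 * (slitKernel (2 * m - 1) 1 + slitKernel (2 * m + 1) 1) := by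
  have h := slitKernel_row m
  rw [sqrtCoeff_of_neg (by omega), Complex.zero_re, mul_zero] at h
  linarith

/-- **The source at the tip**: `K(0, 0) - ½[K(-1, 1) + K(1, 1)] = ½`. [folklore] -/
theorem slitKernel_row_zero : slitKernel 0 0 - 1 / 2 * (slitKernel (-1) 1 + slitKernel 1 1) = 1 / 2 := by
  have h := slitKernel_row 0
  rw [neg_zero, sqrtCoeff_zero, Complex.one_re] at h
  simpa using h

/-- **The flux into the slit**: `K(-2m, 0) - ½[K(-2m-1, 1) + K(-2m+1, 1)] = -binom(2m-2, m-1)/(4^{m-1} · 4m)`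
for `m ≥ 1` (the row defect `½ d_m = -c_{m-1}/(4m)` at the slit site `-2m`). [folklore] -/
theorem slitKernel_row_of_neg (m : ℕ) (hm : 1 ≤ m) :
    slitKernel (2 * (-(m : ℤ))) 0 - 1 / 2 * (slitKernel (2 * (-(m : ℤ)) - 1) 1 + slitKernel (2 * (-(m : ℤ)) + 1) 1) =
      -(((m - 1).centralBinom : ℝ) / 4 ^ (m - 1)) / (4 * m) := by
  rw [slitKernel_row, neg_neg, sqrtCoeff_eq (by exact_mod_cast (by omega : (m : ℤ) ≠ 0))]
  obtain ⟨n, rfl⟩ : ∃ n, m = n + 1 := ⟨m - 1, by omega⟩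
  rw [show ((n + 1 : ℕ) : ℤ) - 1 = (n : ℤ) by push_cast; ring, tipCoeff_natCast, Nat.add_sub_cancel]
  have hn : ((n : ℂ) + 1) ≠ 0 := by exact_mod_cast Nat.succ_ne_zero n
  rw [show -((1 : ℂ) / (2 * (((n + 1 : ℕ) : ℤ) : ℂ))) * ((n.centralBinom : ℂ) / 4 ^ n) =
    ((-(((n.centralBinom : ℝ) / 4 ^ n)) / (2 * (n + 1)) : ℝ) : ℂ) by push_cast; field_simp, ofReal_re]
  push_cast
  field_simp
  ring

/-! ### Kesten's exponent on the row -/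

/-- `(binom(2m,m)/4^m)² (2m+1) ≤ 1` (Wallis). [folklore] -/
theorem centralBinom_div_sq_mul_le (m : ℕ) : ((m.centralBinom : ℝ) / 4 ^ m) ^ 2 * (2 * m + 1) ≤ 1 := by
  induction m with
  | zero => simp [Nat.centralBinom_zero]
  | succ n ih =>
    have hrec := Nat.succ_mul_centralBinom_succ n
    have hrec' : ((n + 1 : ℕ) : ℝ) * ((n + 1).centralBinom : ℝ) = 2 * (2 * (n : ℝ) + 1) * (n.centralBinom : ℝ) := by
      exact_mod_cast hrec
    push_cast at hrec' ⊢
    have hc : ((n + 1).centralBinom : ℝ) = 2 * (2 * n + 1) * n.centralBinom / (n + 1) := by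
      field_simp; linarith
    rw [hc]
    have hpos : (0 : ℝ) < n + 1 := by positivity
    have hC : 0 ≤ (n.centralBinom : ℝ) := by positivity
    have key : (2 * (2 * (n : ℝ) + 1) * n.centralBinom / (n + 1) / 4 ^ (n + 1)) ^ 2 * (2 * (n + 1) + 1) =
        ((n.centralBinom : ℝ) / 4 ^ n) ^ 2 * (2 * n + 1) * ((2 * n + 1) * (2 * n + 3) / (4 * (n + 1) ^ 2)) := by
      rw [pow_succ]; field_simp; ring
    rw [key]
    have h2 : (2 * (n : ℝ) + 1) * (2 * n + 3) / (4 * (n + 1) ^ 2) ≤ 1 := by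
      rw [div_le_one (by positivity)]; nlinarith
    calc ((n.centralBinom : ℝ) / 4 ^ n) ^ 2 * (2 * n + 1) * ((2 * n + 1) * (2 * n + 3) / (4 * (n + 1) ^ 2))
        ≤ 1 * 1 := mul_le_mul ih h2 (by positivity) zero_le_one
      _ = 1 := mul_one _

/-- **Kesten's estimate on the row, with the Wallis constant**: `K(2m, 0) ≤ 1/√(2m+1)`
(CHI (3.3) at the points `z = a + 3δ/2 + 2mδ` of the row, i.e. (2.16) `ϑ(δ) ≤ C₊ δ^{1/2}`; Kesten
1987; Lawler 1991, (2.41)). [cite: ChelkakHonglerIzyurovAnnals2015, Lemma 3.3 (3.3) and (2.16)] -/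
theorem slitKernel_two_mul_natCast_zero_le (m : ℕ) : slitKernel (2 * m) 0 ≤ 1 / Real.sqrt (2 * m + 1) := by
  rw [slitKernel_two_mul_natCast_zero]
  have h := centralBinom_div_sq_mul_le m
  have hpos : (0 : ℝ) < 2 * m + 1 := by positivity
  have hx : 0 ≤ (m.centralBinom : ℝ) / 4 ^ m := by positivity
  rw [le_div_iff₀ (Real.sqrt_pos.2 hpos)]
  have : ((m.centralBinom : ℝ) / 4 ^ m * Real.sqrt (2 * m + 1)) ^ 2 ≤ 1 := by
    rw [mul_pow, Real.sq_sqrt hpos.le]; exact h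
  nlinarith [Real.sqrt_nonneg (2 * (m : ℝ) + 1), sq_nonneg ((m.centralBinom : ℝ) / 4 ^ m * Real.sqrt (2 * m + 1) - 1)]

/-- The row values are nonnegative. [folklore] -/
theorem slitKernel_two_mul_natCast_zero_nonneg (m : ℕ) : 0 ≤ slitKernel (2 * m) 0 := by
  rw [slitKernel_two_mul_natCast_zero]; positivity


/-! ### Part C. The kernel as a lattice function on `ℤ²` -/

/-- **The slit-plane kernel on `ℤ²`**: `slitHM (a, b) = K(a + b, |a - b|)`. In the coordinates
`k = a + b`, `s = a - b` the four lattice neighbours of `(a, b)` are `(k ± 1, s ± 1)`, the diagonal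
`{a = b}` is the row `s = 0`, the slit is the diagonal ray `{(-j, -j) : j ≥ 1}` and the tip is the
origin: CHI's `hm^{Ξ_δ}_{a+3δ/2}` on `𝒱¹_{ℂ_δ} ≅ ℤ²` (proof of Lemma 2.14, (F-1-as-hm)).
[cite: ChelkakHonglerIzyurovAnnals2015, §3.2.2, proof of Lemma 2.14] -/
def slitHM (v : Site 2) : ℝ := slitKernel (v 0 + v 1) (v 0 - v 1).natAbs

/-- Unfolding `slitHM`. [folklore] -/
theorem slitHM_apply (v : Site 2) : slitHM v = slitKernel (v 0 + v 1) (v 0 - v 1).natAbs := rfl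

/-- `slitHM` is symmetric in the two coordinates (reflection in the diagonal). [folklore] -/
theorem slitHM_swap (a b : ℤ) : slitHM ![a, b] = slitHM ![b, a] := by
  simp only [slitHM_apply, Matrix.cons_val_zero, Matrix.cons_val_one]
  rw [add_comm, show (a - b).natAbs = (b - a).natAbs by omega]

/-- **Value at the tip**: `slitHM 0 = 1`. [folklore] -/
theorem slitHM_zero : slitHM 0 = 1 := by
  simp only [slitHM_apply, Pi.zero_apply, add_zero, sub_zero, Int.natAbs_zero]
  exact slitKernel_zero_zero

/-- **Values on the positive diagonal**: `slitHM (j, j) = binom(2j, j)/4^j`. [folklore] -/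
theorem slitHM_diag (j : ℕ) : slitHM ![(j : ℤ), j] = (j.centralBinom : ℝ) / 4 ^ j := by
  simp only [slitHM_apply, Matrix.cons_val_zero, Matrix.cons_val_one, sub_self, Int.natAbs_zero]
  rw [← two_mul]
  exact slitKernel_two_mul_natCast_zero j

/-- **`slitHM` vanishes on the slit**: `slitHM (j, j) = 0` for `j ≤ -1`. [folklore] -/
theorem slitHM_diag_of_neg {j : ℤ} (hj : j ≤ -1) : slitHM ![j, j] = 0 := by
  simp only [slitHM_apply, Matrix.cons_val_zero, Matrix.cons_val_one, sub_self, Int.natAbs_zero]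
  rw [← two_mul]
  exact slitKernel_two_mul_zero_of_neg hj

/-- **Kesten's exponent `1/2` on the diagonal**: `slitHM (j, j) ≤ 1/√(2j+1)` (CHI (2.16), upper
half, with an explicit constant). [cite: ChelkakHonglerIzyurovAnnals2015, (2.16); Kesten1987; Lawler1991, §2.4 (2.41)] -/
theorem slitHM_diag_le (j : ℕ) : slitHM ![(j : ℤ), j] ≤ 1 / Real.sqrt (2 * j + 1) := by
  simp only [slitHM_apply, Matrix.cons_val_zero, Matrix.cons_val_one, sub_self, Int.natAbs_zero]
  rw [← two_mul]
  exact slitKernel_two_mul_natCast_zero_le j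

/-- The diagonal values are nonnegative. [folklore] -/
theorem slitHM_diag_nonneg (j : ℕ) : 0 ≤ slitHM ![(j : ℤ), j] := by
  rw [slitHM_diag]; positivity

/-- The Laplacian of `slitHM` in the coordinates `k = a + b`, `s = a - b`. [folklore] -/
theorem latticeLaplacian_slitHM (v : Site 2) :
    latticeLaplacian slitHM v =
      slitKernel (v 0 + v 1 + 1) (v 0 - v 1 + 1).natAbs + slitKernel (v 0 + v 1 + 1) (v 0 - v 1 - 1).natAbs +
      slitKernel (v 0 + v 1 - 1) (v 0 - v 1 - 1).natAbs + slitKernel (v 0 + v 1 - 1) (v 0 - v 1 + 1).natAbs -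
      4 * slitKernel (v 0 + v 1) (v 0 - v 1).natAbs := by
  rw [latticeLaplacian_eq, Fin.sum_univ_four]
  have c0 : (v + cornerUnit 0) 0 = v 0 + 1 ∧ (v + cornerUnit 0) 1 = v 1 := by simp [cornerUnit]
  have c1 : (v + cornerUnit 1) 0 = v 0 ∧ (v + cornerUnit 1) 1 = v 1 + 1 := by simp [cornerUnit]
  have c2 : (v + cornerUnit 2) 0 = v 0 - 1 ∧ (v + cornerUnit 2) 1 = v 1 := by simp [cornerUnit, sub_eq_add_neg]
  have c3 : (v + cornerUnit 3) 0 = v 0 ∧ (v + cornerUnit 3) 1 = v 1 - 1 := by simp [cornerUnit, sub_eq_add_neg]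
  simp only [slitHM_apply, c0.1, c0.2, c1.1, c1.2, c2.1, c2.2, c3.1, c3.2]
  have e1 : v 0 + 1 + v 1 = v 0 + v 1 + 1 := by ring
  have e2 : v 0 + 1 - v 1 = v 0 - v 1 + 1 := by ring
  have e3 : v 0 + (v 1 + 1) = v 0 + v 1 + 1 := by ring
  have e4 : v 0 - (v 1 + 1) = v 0 - v 1 - 1 := by ring
  have e5 : v 0 - 1 + v 1 = v 0 + v 1 - 1 := by ring
  have e6 : v 0 - 1 - v 1 = v 0 - v 1 - 1 := by ring
  have e7 : v 0 + (v 1 - 1) = v 0 + v 1 - 1 := by ring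
  have e8 : v 0 - (v 1 - 1) = v 0 - v 1 + 1 := by ring
  rw [e1, e2, e3, e4, e5, e6, e7, e8]

/-- **`slitHM` is lattice-harmonic off the diagonal.** [folklore] -/
theorem latticeLaplacian_slitHM_of_ne {v : Site 2} (hv : v 0 ≠ v 1) : latticeLaplacian slitHM v = 0 := by
  rw [latticeLaplacian_slitHM]
  set k := v 0 + v 1
  set n := (v 0 - v 1).natAbs with hn
  have hn1 : 1 ≤ n := by omega
  have h := slitKernel_harmonic k hn1
  rcases lt_or_gt_of_ne hv with hlt | hgt
  · have h1 : (v 0 - v 1 + 1).natAbs = n - 1 := by omega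
    have h2 : (v 0 - v 1 - 1).natAbs = n + 1 := by omega
    rw [h1, h2]; linarith
  · have h1 : (v 0 - v 1 + 1).natAbs = n + 1 := by omega
    have h2 : (v 0 - v 1 - 1).natAbs = n - 1 := by omega
    rw [h1, h2]; linarith

/-- On the diagonal the Laplacian is `-4` times the row defect. [folklore] -/
theorem latticeLaplacian_slitHM_diag (j : ℤ) :
    latticeLaplacian slitHM ![j, j] =
      -4 * (slitKernel (2 * j) 0 - 1 / 2 * (slitKernel (2 * j - 1) 1 + slitKernel (2 * j + 1) 1)) := by
  rw [latticeLaplacian_slitHM]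
  simp only [Matrix.cons_val_zero, Matrix.cons_val_one, sub_self, zero_add, zero_sub, Int.natAbs_zero]
  rw [show (1 : ℤ).natAbs = 1 from rfl, show (-1 : ℤ).natAbs = 1 from rfl, ← two_mul]
  ring

/-- **`slitHM` is lattice-harmonic on the positive diagonal** `(j, j)`, `j ≥ 1`. [folklore] -/
theorem latticeLaplacian_slitHM_diag_of_pos {j : ℤ} (hj : 1 ≤ j) : latticeLaplacian slitHM ![j, j] = 0 := by
  rw [latticeLaplacian_slitHM_diag, slitKernel_row_of_pos hj]
  ring

/-- **The source at the tip**: `Δ slitHM (0) = -2`, i.e. the mean of the four neighbours of the origin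
is `slitHM 0 - 1/2 = 1/2`. [folklore] -/
theorem latticeLaplacian_slitHM_zero : latticeLaplacian slitHM 0 = -2 := by
  have h := latticeLaplacian_slitHM_diag 0
  have h0 : (![(0 : ℤ), 0] : Site 2) = 0 := by
    ext i; fin_cases i <;> rfl
  rw [h0] at h
  rw [h, mul_zero, show (0 : ℤ) - 1 = -1 by norm_num, show (0 : ℤ) + 1 = 1 by norm_num,
    slitKernel_row_zero]
  norm_num

/-- **The flux into the slit**: at the slit site `(-m, -m)`, `m ≥ 1`, where `slitHM = 0`,
`Δ slitHM = binom(2m-2, m-1)/(4^{m-1} m) > 0`. [folklore] -/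
theorem latticeLaplacian_slitHM_diag_of_neg (m : ℕ) (hm : 1 ≤ m) :
    latticeLaplacian slitHM ![-(m : ℤ), -(m : ℤ)] = ((m - 1).centralBinom : ℝ) / 4 ^ (m - 1) / m := by
  rw [latticeLaplacian_slitHM_diag, show (2 : ℤ) * -(m : ℤ) = 2 * (-(m : ℤ)) by ring,
    slitKernel_row_of_neg m hm]
  have hm' : (m : ℝ) ≠ 0 := by exact_mod_cast (by omega : m ≠ 0)
  field_simp

end Literature.Probability.LatticeModels
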